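import Summits.FinalStateConjecture.FinalStateConjecture.Theorems.PhotonSphereChannelsEnergyIdentity

/-!
# Route EIHFluxBalance — `RecedingWellsEnergyBound`: the Doppler multiplier weight

Sixth helper file for the support item stmt-FinalStateConjecture-10168
(`Summit.FinalStateConjecture.FinalStateConjecture.Theses.EIHFluxBalance.RecedingWellsEnergyBound`).
Construction of the weight `β(t, x) = v φ(x / b(t))` of the late-time multiplier
`∫ (e + β m)` for two wells receding at speed `v ∈ (0, 1]` whose supports lie in
`|x ∓ vt| ≤ R`: `φ(s) = 2·smoothTransition((s + 1)/2) − 1` is a smooth monotone odd-type profile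
(`−1` for `s ≤ −1`, `+1` for `s ≥ 1`) and `b(t) = √((vt − 2R)² + R²)` is a smooth, positive,
`v`-Lipschitz width with `b(t) ≤ vt − R` for `t ≥ 2R/v`.  Consequently (`exists_dopplerWeight`)
`β` is `C¹` on `ℝ²` and for `t ≥ 2R/v`: `|β| ≤ v`; `|β_t| ≤ β_x` (rays `x/b = const` are
time-like: the interpolation is causal); `β_x = 0` where `|x| > vt − R`; `β = ±v` for
`±x > vt − R` (β is the well velocity on each well).  These are exactly the hypotheses of
`MovingWells.energy_late_le`.  Elementary calculus [folklore].
-/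

namespace Summit.FinalStateConjecture.FinalStateConjecture.Theorems

open Set Filter Topology

noncomputable section

namespace MovingWells

open WaveEnergy

/-! ### The profile `φ(s) = 2 smoothTransition((s+1)/2) − 1` -/

/-- The derivative of `Real.smoothTransition` vanishes outside `[0, 1]`. -/
theorem deriv_smoothTransition_eq_zero {y : ℝ} (hy : y < 0 ∨ 1 < y) :
    deriv Real.smoothTransition y = 0 := by
  rcases hy with hy | hy
  · have h : Real.smoothTransition =ᶠ[𝓝 y] fun _ => (0 : ℝ) := by
      filter_upwards [Iio_mem_nhds hy] with z hz
      exact Real.smoothTransition.zero_of_nonpos (le_of_lt hz)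
    rw [h.deriv_eq]
    simp
  · have h : Real.smoothTransition =ᶠ[𝓝 y] fun _ => (1 : ℝ) := by
      filter_upwards [Ioi_mem_nhds hy] with z hz
      exact Real.smoothTransition.one_of_one_le (le_of_lt hz)
    rw [h.deriv_eq]
    simp

/-- The profile `φ` is smooth. -/
theorem contDiff_profile {n : ℕ∞} :
    ContDiff ℝ n (fun s : ℝ => 2 * Real.smoothTransition ((s + 1) / 2) - 1) := by
  have h := (Real.smoothTransition.contDiff (n := n)).comp
    ((contDiff_id.add contDiff_const).div_const (2 : ℝ) : ContDiff ℝ n fun s : ℝ => (s + 1) / 2)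
  exact (contDiff_const.mul h).sub contDiff_const

/-- The profile `φ` has derivative `smoothTransition'((s+1)/2)`. -/
theorem hasDerivAt_profile (s : ℝ) :
    HasDerivAt (fun s : ℝ => 2 * Real.smoothTransition ((s + 1) / 2) - 1)
      (deriv Real.smoothTransition ((s + 1) / 2)) s := by
  have hd : Differentiable ℝ Real.smoothTransition :=
    (Real.smoothTransition.contDiff (n := 1)).differentiable (by norm_num)
  have h1 : HasDerivAt (fun s : ℝ => (s + 1) / 2) (1 / 2) s := by
    simpa using ((hasDerivAt_id s).add_const (1 : ℝ)).div_const (2 : ℝ)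
  have h2 := ((hd ((s + 1) / 2)).hasDerivAt.comp s h1).const_mul (2 : ℝ) |>.sub_const (1 : ℝ)
  refine h2.congr_deriv ?_
  ring

/-- `deriv φ s = smoothTransition'((s+1)/2) ≥ 0`, and `= 0` for `|s| > 1`. -/
theorem deriv_profile (s : ℝ) :
    deriv (fun s : ℝ => 2 * Real.smoothTransition ((s + 1) / 2) - 1) s
        = deriv Real.smoothTransition ((s + 1) / 2)
      ∧ 0 ≤ deriv Real.smoothTransition ((s + 1) / 2)
      ∧ (1 < |s| → deriv Real.smoothTransition ((s + 1) / 2) = 0) := by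
  refine ⟨(hasDerivAt_profile s).deriv, Real.smoothTransition.monotone.deriv_nonneg, fun hs => ?_⟩
  apply deriv_smoothTransition_eq_zero
  rcases lt_abs.mp hs with h | h
  · exact Or.inr (by linarith)
  · exact Or.inl (by linarith)

/-- Values of the profile: `|φ| ≤ 1`, `φ = 1` on `[1, ∞)`, `φ = −1` on `(−∞, −1]`. -/
theorem profile_values (s : ℝ) :
    |2 * Real.smoothTransition ((s + 1) / 2) - 1| ≤ 1
      ∧ (1 ≤ s → 2 * Real.smoothTransition ((s + 1) / 2) - 1 = 1)
      ∧ (s ≤ -1 → 2 * Real.smoothTransition ((s + 1) / 2) - 1 = -1) := by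
  refine ⟨?_, fun hs => ?_, fun hs => ?_⟩
  · have h0 := Real.smoothTransition.nonneg ((s + 1) / 2)
    have h1 := Real.smoothTransition.le_one ((s + 1) / 2)
    rw [abs_le]
    constructor <;> linarith
  · rw [Real.smoothTransition.one_of_one_le (by linarith)]
    ring
  · rw [Real.smoothTransition.zero_of_nonpos (by linarith)]
    ring

/-! ### The width `b(t) = √((vt − 2R)² + R²)` -/

/-- `b(t) > 0`, `|vt − 2R| ≤ b(t)`, and `b(t) ≤ vt − R` once `vt ≥ 2R` (`R > 0`). -/
theorem width_values {v R : ℝ} (hR : 0 < R) (t : ℝ) :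
    0 < Real.sqrt ((v * t - 2 * R) ^ 2 + R ^ 2)
      ∧ |v * t - 2 * R| ≤ Real.sqrt ((v * t - 2 * R) ^ 2 + R ^ 2)
      ∧ (2 * R ≤ v * t → Real.sqrt ((v * t - 2 * R) ^ 2 + R ^ 2) ≤ v * t - R) := by
  refine ⟨Real.sqrt_pos.mpr (by positivity), Real.abs_le_sqrt (by nlinarith), fun ht => ?_⟩
  rw [Real.sqrt_le_iff]
  constructor
  · linarith
  · nlinarith

/-- `b` has derivative `v (vt − 2R) / b(t)`, of absolute value `≤ v` (`v ≥ 0`). -/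
theorem hasDerivAt_width {v R : ℝ} (hv : 0 ≤ v) (hR : 0 < R) (t : ℝ) :
    HasDerivAt (fun t : ℝ => Real.sqrt ((v * t - 2 * R) ^ 2 + R ^ 2))
        (v * (v * t - 2 * R) / Real.sqrt ((v * t - 2 * R) ^ 2 + R ^ 2)) t
      ∧ |v * (v * t - 2 * R) / Real.sqrt ((v * t - 2 * R) ^ 2 + R ^ 2)| ≤ v := by
  obtain ⟨hpos, habs, -⟩ := width_values (v := v) hR t
  constructor
  · have h1 : HasDerivAt (fun t : ℝ => (v * t - 2 * R) ^ 2 + R ^ 2) (2 * (v * t - 2 * R) * v) t := by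
      have hl : HasDerivAt (fun t : ℝ => v * t - 2 * R) v t := by
        simpa using ((hasDerivAt_id t).const_mul v).sub_const (2 * R)
      have h := (hl.pow 2).add_const (R ^ 2)
      refine h.congr_deriv ?_
      push_cast
      ring
    have h2 := h1.sqrt (by positivity : (v * t - 2 * R) ^ 2 + R ^ 2 ≠ 0)
    refine h2.congr_deriv ?_
    rw [div_eq_div_iff (by positivity) hpos.ne']
    ring
  · rw [abs_div, abs_mul, abs_of_nonneg hv, abs_of_pos hpos, div_le_iff₀ hpos]
    exact mul_le_mul_of_nonneg_left habs hv

/-! ### The weight `β(t, x) = v φ(x / b(t))` -/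

/-- **The Doppler multiplier weight.** For `0 < v ≤ 1` and `R > 0` there is a `C¹` weight
`β : ℝ × ℝ → ℝ` such that for all `t ≥ 2R/v` and all `x`: `|β(t,x)| ≤ v`,
`|∂ₜβ(t,x)| ≤ ∂ₓβ(t,x)`, `∂ₓβ(t,x) = 0` if `vt − R < |x|`, `β(t,x) = v` if `vt − R < x`, and
`β(t,x) = −v` if `x < −(vt − R)` (namely `β = v φ(x / b(t))` with the profile and width above).
[folklore] -/
theorem exists_dopplerWeight {v R : ℝ} (hv : 0 < v) (hv1 : v ≤ 1) (hR : 0 < R) :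
    ∃ β : ℝ × ℝ → ℝ, ContDiff ℝ 1 β ∧ ∀ t : ℝ, 2 * R / v ≤ t → ∀ x : ℝ,
      |β (t, x)| ≤ v
        ∧ |fderiv ℝ β (t, x) (1, 0)| ≤ fderiv ℝ β (t, x) (0, 1)
        ∧ (v * t - R < |x| → fderiv ℝ β (t, x) (0, 1) = 0)
        ∧ (v * t - R < x → β (t, x) = v)
        ∧ (x < -(v * t - R) → β (t, x) = -v) := by
  set φ : ℝ → ℝ := fun s => 2 * Real.smoothTransition ((s + 1) / 2) - 1 with hφ
  set b : ℝ → ℝ := fun t => Real.sqrt ((v * t - 2 * R) ^ 2 + R ^ 2) with hb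
  set b' : ℝ → ℝ := fun t => v * (v * t - 2 * R) / Real.sqrt ((v * t - 2 * R) ^ 2 + R ^ 2) with hb'
  have hbpos : ∀ t, 0 < b t := fun t => (width_values (v := v) hR t).1
  have hbd : ∀ t, HasDerivAt b (b' t) t := fun t => (hasDerivAt_width hv.le hR t).1
  have hb'le : ∀ t, |b' t| ≤ v := fun t => (hasDerivAt_width hv.le hR t).2
  have hφd : ∀ s, HasDerivAt φ (deriv Real.smoothTransition ((s + 1) / 2)) s := hasDerivAt_profile
  set β : ℝ × ℝ → ℝ := fun z => v * φ (z.2 / b z.1) with hβ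
  -- regularity
  have hbC : ContDiff ℝ 1 b := by
    simp only [hb]
    exact ContDiff.sqrt (by fun_prop) fun t => (by positivity : (v * t - 2 * R) ^ 2 + R ^ 2 ≠ 0)
  have hβC : ContDiff ℝ 1 β := by
    simp only [hβ]
    refine contDiff_const.mul ((contDiff_profile (n := 1)).comp ?_)
    exact contDiff_snd.div (hbC.comp contDiff_fst) fun z => (hbpos z.1).ne'
  have hβdiff : Differentiable ℝ β := hβC.differentiable (by norm_num)
  -- partial derivatives
  have hβx : ∀ t x, fderiv ℝ β (t, x) (0, 1)
      = v * (deriv Real.smoothTransition ((x / b t + 1) / 2) * (1 / b t)) := by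
    intro t x
    have hs : HasDerivAt (fun y => β (t, y))
        (v * (deriv Real.smoothTransition ((x / b t + 1) / 2) * (1 / b t))) x := by
      have h1 : HasDerivAt (fun y : ℝ => y / b t) (1 / b t) x := by
        simpa using (hasDerivAt_id x).div_const (b t)
      exact ((hφd (x / b t)).comp x h1).const_mul v
    exact (hasDerivAt_slice_snd hβdiff t x).unique hs
  have hβt : ∀ t x, fderiv ℝ β (t, x) (1, 0)
      = v * (deriv Real.smoothTransition ((x / b t + 1) / 2) * (x * (-(b' t) / (b t) ^ 2))) := by
    intro t x
    have hs : HasDerivAt (fun τ => β (τ, x))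
        (v * (deriv Real.smoothTransition ((x / b t + 1) / 2) * (x * (-(b' t) / (b t) ^ 2)))) t := by
      have h1 : HasDerivAt (fun τ : ℝ => x / b τ) (x * (-(b' t) / (b t) ^ 2)) t := by
        have h := ((hbd t).inv (hbpos t).ne').const_mul x
        have hfun : (fun τ : ℝ => x / b τ) = fun τ => x * (b τ)⁻¹ := funext fun τ => div_eq_mul_inv _ _
        rw [hfun]
        exact h
      exact ((hφd (x / b t)).comp t h1).const_mul v
    exact (hasDerivAt_slice_fst hβdiff t x).unique hs
  refine ⟨β, hβC, fun t ht x => ?_⟩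
  have hvt : 2 * R ≤ v * t := by
    have := (div_le_iff₀ hv).mp ht
    linarith
  obtain ⟨hbp, -, hble⟩ := width_values (v := v) hR t
  have hble := hble hvt
  have hbp' : 0 < b t := hbp
  obtain ⟨-, hφ'0, hφ'z⟩ := deriv_profile (x / b t)
  obtain ⟨hφabs, hφone, hφneg⟩ := profile_values (x / b t)
  -- `|x| > b t` forces `φ' (x / b t) = 0`
  have hout : b t < |x| → deriv Real.smoothTransition ((x / b t + 1) / 2) = 0 := by
    intro hx
    apply hφ'z
    rw [abs_div, abs_of_pos hbp', lt_div_iff₀ hbp']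
    linarith
  refine ⟨?_, ?_, fun hx => ?_, fun hx => ?_, fun hx => ?_⟩
  · -- `|β| ≤ v`
    simp only [hβ, hφ, abs_mul, abs_of_pos hv]
    exact mul_le_of_le_one_right hv.le hφabs
  · -- `|β_t| ≤ β_x`
    rw [hβt, hβx]
    rcases le_or_gt |x| (b t) with hx | hx
    · have key : |x| * |b' t| ≤ b t := by
        calc |x| * |b' t| ≤ b t * 1 := mul_le_mul hx ((hb'le t).trans hv1) (abs_nonneg _) hbp'.le
          _ = b t := mul_one _
      have hb'x : |x * (-(b' t) / b t ^ 2)| ≤ 1 / b t := by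
        have h3 : |x * (-(b' t) / b t ^ 2)| = |x| * |b' t| / b t ^ 2 := by
          rw [abs_mul, abs_div, abs_neg, abs_of_pos (by positivity : 0 < b t ^ 2)]
          ring
        have h4 : 1 / b t * b t ^ 2 = b t := by
          rw [div_mul_eq_mul_div, one_mul, sq, mul_div_assoc, div_self hbp'.ne', mul_one]
        rw [h3, div_le_iff₀ (by positivity : 0 < b t ^ 2), h4]
        exact key
      rw [abs_mul, abs_of_pos hv, abs_mul, abs_of_nonneg hφ'0]
      exact mul_le_mul_of_nonneg_left (mul_le_mul_of_nonneg_left hb'x hφ'0) hv.le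
    · rw [hout hx]
      simp
  · -- `β_x = 0` outside `|x| ≤ vt - R`
    rw [hβx, hout (lt_of_le_of_lt hble hx)]
    simp
  · -- `β = v` to the right
    have hs : 1 ≤ x / b t := by
      rw [le_div_iff₀ hbp']
      linarith
    simp only [hβ, hφ]
    rw [hφone hs, mul_one]
  · -- `β = -v` to the left
    have hs : x / b t ≤ -1 := by
      rw [div_le_iff₀ hbp']
      linarith
    simp only [hβ, hφ]
    rw [hφneg hs]
    ring

end MovingWells

end

end Summit.FinalStateConjecture.FinalStateConjecture.Theorems
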